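import Literature.NumberTheory.EllipticCurves.BDPAnticyclotomicPAdicLFunctionUpTo
import Summits.BirchSwinnertonDyer.Rank1Residual.X11b.BDPValueRigidity
import HarnessLib

set_option linter.dupNamespace false -- `Summit.BirchSwinnertonDyer.BirchSwinnertonDyer.Theorems.…` (summit = sub)
set_option autoImplicit false

/-!
# Route `CongruentShaFreeCut` (rung S2) — LEMMA R: value-at-𝟙 RIGIDITY of the BDP frame UP TO A
# CONSTANT (`IsBDPLFunctionUpTo C`), any prime `p`

Cell `bsd-cn100`, prover seat `bsd-cn100-transfer` (g11), target of record of the plan seat (plan g14,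
STATUS 2026-08-26T23:15:12Z (2); `HOME/bsd-cn100-plan/D0074-bsd-cn100-seats.md` §6 addendum 7): the Lean
form of **LEMMA R** of `HOME/MEMO-transfer-13.md` §5.4 ("rigidity of the ♯-frame"), the elementary step that
transports the BDP value formula at the trivial character from ONE admissible tuple `(C, Ω_K, Ω_p, 𝓛)` to
EVERY admissible tuple — the ∀-form in which the registered ♯-stub
`…Theorems.CongruentShaFreeCutTwoAdicBDPTripleUpTo.TwoAdicBDPValueAtOneUpTo` (stmt-BirchSwinnertonDyer-19079,
line `heegner-field-bdp-triple-upto` v6cp) is typed. Supports, does not close, stmt-BirchSwinnertonDyer-19079.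
THEOREMS ONLY (no definition, no named fact, no `sorry`); pure `p`-adic analysis on `R₀⟦T⟧` plus the
period/constant bookkeeping of the display; valid at every prime `p`. HONEST FRAMING: nothing here proves
(LB-exist♯), (LB-wan♯), (LB-bdp♯), crux A, crux B, the leaf `rankOne_twoConverse_congruentNumber`, the
congruent number problem or any case of BSD; the CHARACTER SUPPLY is a HYPOTHESIS (the tree does not
construct Hecke characters of prescribed infinity type). PARTITION: none — RANK axis.

## The statement (MEMO-transfer-13 §5.4, sharpened)

Two tuples `(C, Ω_K, Ω_p, L)`, `(C', Ω_K', Ω_p', L')` with `IsBDPLFunctionUpTo C ι 𝔭 κ γ f Ω_K Ω_p L`,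
`IsBDPLFunctionUpTo C' ι 𝔭 κ γ f Ω_K' Ω_p' L'` for the SAME `(ι, 𝔭, κ, γ, f)`, all of `C, C', Ω_K, Ω_K',
Ω_p, Ω_p'` non-zero, take at an interpolation point of infinity type `(n, −n)` values tied by
`L'(T_φ) = (C'/C) · β^n · L(T_φ)`, `β := ι⁻¹((Ω_K/Ω_K')⁴)·(Ω_p'/Ω_p)⁴` (`hasValueAt_frameUpTo_rescale`). Given a
character supply accumulating at `𝟙` (the S27 binders of `X11b/BDPValueRigidity.lean`, verbatim: `m > 0`,
`x₀^{p^k} → 1`, interpolation data of types `m p^k` and `2 m p^k` with avatar values `x₀^{p^k}`, `x₀^{2p^k}`):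

  `[T⁰]L' = (C'/C) · [T⁰]L` in `ℂ_p`   (`coe_constantCoeff_eq_mul_of_isBDPLFunctionUpTo_of_supply`),

hence `[T⁰]L = 0 ↔ [T⁰]L' = 0` and, when non-zero, `L'(𝟙) = G₀ · L(𝟙)` with `G₀ = C'/C ∈ ℂ_p^×` EXACTLY — the
memo's Lemma R with its `G₀ ∈ ℂ_p^×` pinned (the memo's root of unity `ζ_{k₀}` is `1`: see the proof).

## Proof (no Strassmann / identity principle, no rate estimate)

The ABSTRACT CORE of `X11b/UnrSeriesValueRigidity.lean` (`Halves.constantCoeff_eq_of_values_mul_sq`, S27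
'V1RIG') carried through with one EXTERNAL CONSTANT `A ∈ ℂ_p^×` (§1, this file): along `T_k → 0` let `L, L'`
take the values `v_k`, `A·a_k·v_k` at `T_k` and `w_k`, `A·a_k²·w_k` at `T_k(T_k + 2) = (1 + T_k)² − 1`, `a_k ≠ 0`;
then `[T⁰]L' = A·[T⁰]L`. Indeed if `c := [T⁰]L ≠ 0`: all four value sequences converge to the constant
terms (continuity of evaluation at `𝟙`), so `a_k → ρ := c'/(A c)` AND `a_k² → ρ`, whence `ρ² = ρ`; `ρ = 0`
is impossible (then `c' = 0`, `a_k → 0`, `L' ≠ 0`, and the ORDER LEMMA at `T_k` and at `T_k(T_k+2)` gives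
`‖a_k‖ = ‖2‖^d ≠ 0` for large `k`); so `ρ = 1`, `c' = A c`. If `c = 0 ≠ c'` swap the series (`A ↦ A⁻¹`,
`a_k ↦ a_k⁻¹`). With `T_k := x₀^{p^k} − 1`, `a_k := β^{m p^k}`, `A := C'/C` this is Lemma R (§3). MEMO-13's
own argument (§5.4 (iii): growth comparison `|B|^{−2p^k}` vs `p^{−kd}` + Strassmann on a closed sub-disc)
is thereby AVOIDED: the second supply (type `2 m p^k`) replaces it.

## Contents

* §1 `coe_constantCoeff_eq_mul_of_values_mul_sq_of_ne_zero`, `coe_constantCoeff_eq_mul_of_values_mul_sq`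
  — the abstract core with a constant (adapted from `…X11b.Halves.constantCoeff_eq_of_values_mul_sq`).
* §2 `hasValueAt_frameUpTo_rescale` — the ♯-frames' values differ by `(C'/C)·β^n`
  (`…X11b.frameValue_rescale`).
* §3 `coe_constantCoeff_eq_mul_of_isBDPLFunctionUpTo_of_supply` (LEMMA R).

The corollaries in the memo's wording (`L(𝟙) = 0 ⟺ L'(𝟙) = 0`; `C' = C ⟹ [T⁰]L' = [T⁰]L`, i.e. S27 at
`C = C' = 1`) and the `p = 2` READING for the registered stub (the ∀-form `TwoAdicBDPValueAtOneUpTo` from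
ONE admissible tuple with the value formula + the supply) are the sibling
`Theorems/CongruentShaFreeCutBDPUpToRigidityReadings.lean` (this file imports no `Theses` module and no
`p = 2` object; 400-line rule).

References: [Castella2018] F. Castella, Camb. J. Math. 6 (2018), Thm. 3.1–3.2 (arXiv:1704.06608 pp. 8–9);
[CastellaHsieh2018] Math. Ann. 370 (2018), §3.3, Prop. 3.4, Def. 3.5, Prop. 3.6; [Cassels1986] Ch. 4
(values of power series on the open disc).
-/

noncomputable section

open scoped Classical Topology

open Filter PowerSeries NumberField IsDedekindDomain Field
  Literature.NumberTheory.EllipticCurves Literature.NumberTheory.GaloisRepresentations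

namespace Summit.BirchSwinnertonDyer.BirchSwinnertonDyer.Theorems.CongruentShaFreeCutBDPUpToRigidity

open Summit.BirchSwinnertonDyer.Rank1Residual.X11b.Halves
open Summit.BirchSwinnertonDyer.Rank1Residual.X11b (frameValue_rescale)

variable {p : ℕ} [Fact p.Prime]

/-! ### §1 The abstract core with an external constant `A ∈ ℂ_p^×` -/

/-- **Abstract core with a constant, one-sided** (`[T⁰]L ≠ 0`). Along `T_k → 0` let `L, L' ∈ R₀⟦T⟧` take
the values `v_k`, `A·a_k·v_k` at `T_k` and `w_k`, `A·a_k²·w_k` at `T_k·(T_k + 2) = (1 + T_k)² − 1`, with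
`a_k ≠ 0` and a FIXED `A ∈ ℂ_p`, `A ≠ 0`. Then `[T⁰]L' = A·[T⁰]L` (in `ℂ_p`). PROOF: the four value sequences
converge to `c ≠ 0`, `c`, `c'`, `c'` (continuity of evaluation at `𝟙`), hence `a_k → ρ := c'/(A c)` and
`a_k² → ρ`, so `ρ² = ρ`. If `ρ = 0` then `c' = 0`, `a_k → 0`, `L' ≠ 0` (its value `A a_k v_k ≠ 0` for large
`k`), and with `d` the order of `L'`, `g₀ = [T^d]L'`, the ORDER LEMMA (`Halves.norm_value_eq_of_order`) gives
for large `k`: `‖A‖‖a_k‖‖c‖ = ‖T_k‖^d‖g₀‖` and `‖A‖‖a_k‖²‖c‖ = ‖T_k‖^d‖2‖^d‖g₀‖`, i.e. `‖a_k‖ = ‖2‖^d ≠ 0` —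
contradiction; so `ρ = 1` and `c' = A c`. Adapted from `…X11b.Halves.constantCoeff_eq_of_values_mul_sq_of_ne_zero`
(the case `A = 1`). [folklore] -/
theorem coe_constantCoeff_eq_mul_of_values_mul_sq_of_ne_zero {L L' : UnrSeries p}
    {T v w a : ℕ → ℂ_[p]} {A : ℂ_[p]}
    (hT0 : Tendsto T atTop (𝓝 0)) (ha : ∀ k, a k ≠ 0) (hA : A ≠ 0)
    (hv : ∀ k, L.HasValueAt (T k) (v k)) (hv' : ∀ k, L'.HasValueAt (T k) (A * a k * v k))
    (hw : ∀ k, L.HasValueAt (T k * (T k + 2)) (w k))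
    (hw' : ∀ k, L'.HasValueAt (T k * (T k + 2)) (A * a k ^ 2 * w k))
    (hc : PowerSeries.constantCoeff L ≠ 0) :
    ((PowerSeries.constantCoeff L' : unrIntegers p) : ℂ_[p]) =
      A * ((PowerSeries.constantCoeff L : unrIntegers p) : ℂ_[p]) := by
  -- adapted from Summits/BirchSwinnertonDyer/Rank1Residual/X11b/UnrSeriesValueRigidity.lean (S27 'V1RIG')
  set c : ℂ_[p] := ((PowerSeries.constantCoeff L : unrIntegers p) : ℂ_[p]) with hcdef
  set c' : ℂ_[p] := ((PowerSeries.constantCoeff L' : unrIntegers p) : ℂ_[p]) with hc'def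
  have hc0 : c ≠ 0 := by
    rw [hcdef, Ne, ZeroMemClass.coe_eq_zero]
    exact hc
  have hAc0 : A * c ≠ 0 := mul_ne_zero hA hc0
  have hT2 : Tendsto (fun k ↦ T k + 2) atTop (𝓝 2) := by simpa using hT0.add_const 2
  have hT'0 : Tendsto (fun k ↦ T k * (T k + 2)) atTop (𝓝 0) := by simpa using hT0.mul hT2
  -- (i) the four limits
  have hv_lim : Tendsto v atTop (𝓝 c) := tendsto_value_constantCoeff hT0 hv
  have hw_lim : Tendsto w atTop (𝓝 c) := tendsto_value_constantCoeff hT'0 hw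
  have hav_lim : Tendsto (fun k ↦ A * a k * v k) atTop (𝓝 c') := tendsto_value_constantCoeff hT0 hv'
  have haw_lim : Tendsto (fun k ↦ A * a k ^ 2 * w k) atTop (𝓝 c') :=
    tendsto_value_constantCoeff hT'0 hw'
  have hvne : ∀ᶠ k in atTop, v k ≠ 0 := by
    filter_upwards [eventually_norm_eq_of_tendsto hc0 hv_lim] with k hk
    rw [← norm_ne_zero_iff, hk, norm_ne_zero_iff]
    exact hc0
  have hwne : ∀ᶠ k in atTop, w k ≠ 0 := by
    filter_upwards [eventually_norm_eq_of_tendsto hc0 hw_lim] with k hk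
    rw [← norm_ne_zero_iff, hk, norm_ne_zero_iff]
    exact hc0
  -- (ii) `a_k → ρ` and `a_k² → ρ`, `ρ := c' / (A c)`
  set ρ : ℂ_[p] := c' / (A * c) with hρdef
  have hAv_lim : Tendsto (fun k ↦ A * v k) atTop (𝓝 (A * c)) := hv_lim.const_mul A
  have hAw_lim : Tendsto (fun k ↦ A * w k) atTop (𝓝 (A * c)) := hw_lim.const_mul A
  have ha_lim : Tendsto a atTop (𝓝 ρ) := by
    refine (hav_lim.div hAv_lim hAc0).congr' ?_
    filter_upwards [hvne] with k hk
    simp only [Pi.div_apply]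
    have h : A * a k * v k = a k * (A * v k) := by ring
    rw [h]
    exact mul_div_cancel_right₀ (a k) (mul_ne_zero hA hk)
  have ha2_lim : Tendsto (fun k ↦ a k ^ 2) atTop (𝓝 ρ) := by
    refine (haw_lim.div hAw_lim hAc0).congr' ?_
    filter_upwards [hwne] with k hk
    simp only [Pi.div_apply]
    have h : A * a k ^ 2 * w k = a k ^ 2 * (A * w k) := by ring
    rw [h]
    exact mul_div_cancel_right₀ (a k ^ 2) (mul_ne_zero hA hk)
  have hρsq : ρ ^ 2 = ρ := tendsto_nhds_unique (ha_lim.pow 2) ha2_lim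
  have hc'ρ : c' = ρ * (A * c) := by rw [hρdef, div_mul_cancel₀ _ hAc0]
  have hρ01 : ρ = 0 ∨ ρ = 1 := by
    have h : ρ * (ρ - 1) = 0 := by rw [mul_sub, mul_one, ← sq, hρsq, sub_self]
    rcases mul_eq_zero.mp h with h | h
    · exact Or.inl h
    · exact Or.inr (sub_eq_zero.mp h)
  rcases hρ01 with hρ0 | hρ1
  · -- (ii') `ρ = 0` is impossible
    exfalso
    have ha0 : Tendsto a atTop (𝓝 0) := hρ0 ▸ ha_lim
    obtain ⟨K, hK⟩ := hvne.exists
    have hL'ne : L' ≠ 0 := by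
      intro h0
      have h00 := hasValueAt_zero_series (p := p) (T K)
      rw [← h0] at h00
      exact mul_ne_zero (mul_ne_zero hA (ha K)) hK ((hv' K).unique h00)
    set d : ℕ := L'.order.toNat with hddef
    set g₀ : ℂ_[p] := ((PowerSeries.coeff d L' : unrIntegers p) : ℂ_[p]) with hg₀def
    have hg₀ : g₀ ≠ 0 := by
      rw [hg₀def, Ne, ZeroMemClass.coe_eq_zero, hddef]
      exact PowerSeries.coeff_order hL'ne
    have hg₀pos : 0 < ‖g₀‖ := norm_pos_iff.mpr hg₀
    have h2pos : 0 < ‖(2 : ℂ_[p])‖ := norm_pos_iff.mpr two_ne_zero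
    have h2d : 0 < ‖(2 : ℂ_[p])‖ ^ d := pow_pos h2pos d
    -- eventually-facts
    have hTn : Tendsto (fun k ↦ ‖T k‖) atTop (𝓝 0) := tendsto_zero_iff_norm_tendsto_zero.mp hT0
    have hT'n : Tendsto (fun k ↦ ‖T k * (T k + 2)‖) atTop (𝓝 0) :=
      tendsto_zero_iff_norm_tendsto_zero.mp hT'0
    have han : Tendsto (fun k ↦ ‖a k‖) atTop (𝓝 0) := tendsto_zero_iff_norm_tendsto_zero.mp ha0
    have E1 : ∀ᶠ k in atTop, ‖T k‖ < 1 := hTn.eventually_lt_const zero_lt_one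
    have E2 : ∀ᶠ k in atTop, ‖T k‖ < ‖g₀‖ := hTn.eventually_lt_const hg₀pos
    have E3 : ∀ᶠ k in atTop, ‖T k * (T k + 2)‖ < 1 := hT'n.eventually_lt_const zero_lt_one
    have E4 : ∀ᶠ k in atTop, ‖T k * (T k + 2)‖ < ‖g₀‖ := hT'n.eventually_lt_const hg₀pos
    have E5 : ∀ᶠ k in atTop, ‖v k‖ = ‖c‖ := eventually_norm_eq_of_tendsto hc0 hv_lim
    have E6 : ∀ᶠ k in atTop, ‖w k‖ = ‖c‖ := eventually_norm_eq_of_tendsto hc0 hw_lim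
    have E7 : ∀ᶠ k in atTop, ‖T k + 2‖ = ‖(2 : ℂ_[p])‖ :=
      eventually_norm_eq_of_tendsto two_ne_zero hT2
    have E8 : ∀ᶠ k in atTop, ‖a k‖ < ‖(2 : ℂ_[p])‖ ^ d := han.eventually_lt_const h2d
    obtain ⟨k, h1, h2, h3, h4, h5, h6, h7, h8⟩ :=
      (E1.and (E2.and (E3.and (E4.and (E5.and (E6.and (E7.and E8))))))).exists
    have eA : ‖A‖ * ‖a k‖ * ‖c‖ = ‖T k‖ ^ d * ‖g₀‖ := by
      rw [← h5, ← norm_mul A (a k), ← norm_mul (A * a k) (v k)]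
      exact norm_value_eq_of_order h1 h2 (hv' k)
    have eB : ‖A‖ * ‖a k‖ ^ 2 * ‖c‖ = ‖T k‖ ^ d * ‖(2 : ℂ_[p])‖ ^ d * ‖g₀‖ := by
      rw [← h7, ← mul_pow, ← norm_mul (T k) (T k + 2), ← h6, ← norm_pow (a k) 2,
        ← norm_mul A (a k ^ 2), ← norm_mul (A * a k ^ 2) (w k)]
      exact norm_value_eq_of_order h3 h4 (hw' k)
    have eB' : ‖A‖ * ‖a k‖ ^ 2 * ‖c‖ = ‖(2 : ℂ_[p])‖ ^ d * (‖A‖ * ‖a k‖ * ‖c‖) := by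
      rw [eB, eA]; ring
    have hcpos : 0 < ‖c‖ := norm_pos_iff.mpr hc0
    have hak : ‖a k‖ = ‖(2 : ℂ_[p])‖ ^ d := by
      have hne : ‖A‖ * ‖a k‖ * ‖c‖ ≠ 0 :=
        mul_ne_zero (mul_ne_zero (norm_ne_zero_iff.mpr hA) (norm_ne_zero_iff.mpr (ha k))) hcpos.ne'
      have : ‖a k‖ * (‖A‖ * ‖a k‖ * ‖c‖) = ‖(2 : ℂ_[p])‖ ^ d * (‖A‖ * ‖a k‖ * ‖c‖) := by
        rw [← eB']; ring
      exact mul_right_cancel₀ hne this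
    exact (lt_irrefl _) (hak ▸ h8)
  · -- (iii) `ρ = 1`: `c' = A c`
    rw [hc'ρ, hρ1, one_mul]

/-- **Abstract core with a constant (symmetric form).** As in the one-sided version, WITHOUT `[T⁰]L ≠ 0`:
if `[T⁰]L = 0 ≠ [T⁰]L'` swap the roles of the series (`A ↦ A⁻¹`, `a_k ↦ a_k⁻¹`) to get `[T⁰]L = A⁻¹·[T⁰]L' ≠ 0`,
absurd; if both constant terms vanish, `0 = A·0`. Adapted from `…X11b.Halves.constantCoeff_eq_of_values_mul_sq`.
[folklore] -/
theorem coe_constantCoeff_eq_mul_of_values_mul_sq {L L' : UnrSeries p} {T v w a : ℕ → ℂ_[p]}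
    {A : ℂ_[p]} (hT0 : Tendsto T atTop (𝓝 0)) (ha : ∀ k, a k ≠ 0) (hA : A ≠ 0)
    (hv : ∀ k, L.HasValueAt (T k) (v k)) (hv' : ∀ k, L'.HasValueAt (T k) (A * a k * v k))
    (hw : ∀ k, L.HasValueAt (T k * (T k + 2)) (w k))
    (hw' : ∀ k, L'.HasValueAt (T k * (T k + 2)) (A * a k ^ 2 * w k)) :
    ((PowerSeries.constantCoeff L' : unrIntegers p) : ℂ_[p]) =
      A * ((PowerSeries.constantCoeff L : unrIntegers p) : ℂ_[p]) := by
  by_cases hc : PowerSeries.constantCoeff L = 0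
  · by_cases hc' : PowerSeries.constantCoeff L' = 0
    · rw [hc, hc', ZeroMemClass.coe_zero, mul_zero]
    · exfalso
      have e1 : ∀ k, A⁻¹ * (a k)⁻¹ * (A * a k * v k) = v k := fun k ↦ by
        have hak := ha k
        field_simp
      have e2 : ∀ k, A⁻¹ * (a k)⁻¹ ^ 2 * (A * a k ^ 2 * w k) = w k := fun k ↦ by
        have hak := ha k
        field_simp
      have h := coe_constantCoeff_eq_mul_of_values_mul_sq_of_ne_zero (L := L') (L' := L) (A := A⁻¹)
        (a := fun k ↦ (a k)⁻¹) (v := fun k ↦ A * a k * v k) (w := fun k ↦ A * a k ^ 2 * w k)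
        hT0 (fun k ↦ inv_ne_zero (ha k)) (inv_ne_zero hA) hv'
        (fun k ↦ by simpa only [e1] using hv k) hw' (fun k ↦ by simpa only [e2] using hw k) hc'
      rw [hc, ZeroMemClass.coe_zero, eq_comm, mul_eq_zero, _root_.inv_eq_zero,
        ZeroMemClass.coe_eq_zero] at h
      rcases h with h | h
      · exact hA h
      · exact hc' h
  · exact coe_constantCoeff_eq_mul_of_values_mul_sq_of_ne_zero hT0 ha hA hv hv' hw hw' hc

/-! ### §2 The ♯-frames' values differ by `(C'/C)·β^n` -/

section Frame

variable {K : Type} [Field K] [NumberField K] {N : ℕ}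

/-- **At an interpolation point the second ♯-frame takes `(C'/C)·β^n` times the first ♯-frame's value**,
`β := ι⁻¹((Ω_K/Ω_K')⁴)·(Ω_p'/Ω_p)⁴`: if `IsBDPLFunctionUpTo C' ι 𝔭 κ γ f Ω_K' Ω_p' L'` then at `T = φ̂(γ) − 1`,
`φ` of infinity type `(n, −n)`, `L'` has the value `(C'/C)·β^n·(C·ι⁻¹(value(Ω_K))·Ω_p^{4n})`
(`…X11b.frameValue_rescale`; `C, Ω_K, Ω_K', Ω_p ≠ 0`). [cite: Castella2018, Thm. 3.1 (arXiv:1704.06608 p. 9)] -/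
theorem hasValueAt_frameUpTo_rescale {ι : PadicAlgCl p ≃+* ℂ} {𝔭 : HeightOneSpectrum (𝓞 K)}
    {κ : ZpExtension K p} {γ : Field.absoluteGaloisGroup K}
    {f : CuspForm (CongruenceSubgroup.Gamma0 N) 2} {ΩK ΩK' : ℂ} {Ωp Ωp' C C' : ℂ_[p]}
    {L' : UnrSeries p} (hΩK : ΩK ≠ 0) (hΩK' : ΩK' ≠ 0) (hΩp : Ωp ≠ 0) (hC : C ≠ 0)
    (hL' : IsBDPLFunctionUpTo C' ι 𝔭 κ γ f ΩK' Ωp' L')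
    {φ : HeckeCharacter K} {n : ℕ} {r : FramedGaloisRep K (PadicAlgCl p) 1} (hn : 0 < n)
    (hunr : ∀ v : HeightOneSpectrum (𝓞 K), φ.IsUnramifiedAt v)
    (hinf : φ.HasInfinityType (fun _ ↦ (n : ℤ)) (fun _ ↦ -(n : ℤ)))
    (hr : IsPAdicAvatarOf ι φ r) (hκ : FactorsThroughZp κ r) :
    L'.HasValueAt (avatarValueAt r γ - 1)
      (C' / C * (((ι.symm ((ΩK / ΩK') ^ 4) : PadicAlgCl p) : ℂ_[p]) * (Ωp' / Ωp) ^ 4) ^ n *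
        (C * (((ι.symm (bdpInterpolationValue p f 𝔭 φ n ΩK) : PadicAlgCl p) : ℂ_[p]) *
          Ωp ^ (4 * n)))) := by
  have h := hL'.hasValueAt hn hunr hinf hr hκ
  rw [frameValue_rescale ι f 𝔭 φ n hΩK hΩK' Ωp' hΩp] at h
  have e : C' * (((ι.symm (bdpInterpolationValue p f 𝔭 φ n ΩK) : PadicAlgCl p) : ℂ_[p]) *
        Ωp ^ (4 * n) * (((ι.symm ((ΩK / ΩK') ^ 4) : PadicAlgCl p) : ℂ_[p]) * (Ωp' / Ωp) ^ 4) ^ n) =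
      C' / C * (((ι.symm ((ΩK / ΩK') ^ 4) : PadicAlgCl p) : ℂ_[p]) * (Ωp' / Ωp) ^ 4) ^ n *
        (C * (((ι.symm (bdpInterpolationValue p f 𝔭 φ n ΩK) : PadicAlgCl p) : ℂ_[p]) *
          Ωp ^ (4 * n))) := by
    field_simp
  rw [e] at h
  exact h

end Frame

/-! ### §3 LEMMA R: `[T⁰]L' = (C'/C)·[T⁰]L` across ♯-frames, given a character supply -/

/-- **LEMMA R (MEMO-transfer-13 §5.4), sharpened: VALUE-AT-𝟙 RIGIDITY OF THE ♯-FRAME ACROSS PERIODS AND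
CONSTANTS**, any prime `p`. For two tuples `IsBDPLFunctionUpTo C ι 𝔭 κ γ f Ω_K Ω_p L`,
`IsBDPLFunctionUpTo C' ι 𝔭 κ γ f Ω_K' Ω_p' L'` of the SAME `(ι, 𝔭, κ, γ, f)` with `Ω_K, Ω_K', Ω_p, Ω_p', C, C'`
non-zero, and a CHARACTER SUPPLY at `(ι, κ, γ)` — the S27 binders of
`…X11b.constantCoeff_eq_of_isBDPLFunction_of_supply` verbatim: `m > 0`, `x₀ ∈ ℂ_p` with `x₀^(p^k) → 1`, and
for every `k` interpolation data `(φ_k, m·p^k, r_k)`, `(φ'_k, 2m·p^k, r'_k)` (unramified, of the displayed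
infinity types, avatars through `κ`) with avatar values `x₀^(p^k)`, `x₀^(2·p^k)` at `γ` —:

  `[T⁰]L' = (C'/C) · [T⁰]L` in `ℂ_p`.

So the value at the trivial character sees the periods and the constant ONLY through the scalar `C'/C`:
`L(𝟙) = 0 ⟺ L'(𝟙) = 0`, and otherwise `L'(𝟙) = G₀·L(𝟙)` with `G₀ = C'/C ≠ 0` (the memo's `G₀`, pinned). Proof:
§1 with `T_k := x₀^(p^k) − 1 → 0`, `a_k := β^(m p^k)`, `A := C'/C` (§2: `x₀^(2p^k) − 1 = T_k(T_k + 2)`,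
`β^(2mp^k) = a_k²`). The supply is a HYPOTHESIS (in nature: powers of one unramified anticyclotomic
character of infinity type `(1, −1)`; the tree does not construct Hecke characters of prescribed type).
[cite: Castella2018, Thm. 3.1–3.2 (arXiv:1704.06608 pp. 8–9) (interpolation shape; the rigidity statement is elementary p-adic analysis on R₀⟦T⟧)]
[cite: CastellaHsieh2018, §3.3, Def. 3.5 and Prop. 3.6] -/
theorem coe_constantCoeff_eq_mul_of_isBDPLFunctionUpTo_of_supply (K : Type) [Field K] [NumberField K]
    (N : ℕ) (ι : PadicAlgCl p ≃+* ℂ) (𝔭 : HeightOneSpectrum (𝓞 K)) (κ : ZpExtension K p)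
    (γ : Field.absoluteGaloisGroup K) (f : CuspForm (CongruenceSubgroup.Gamma0 N) 2) (ΩK ΩK' : ℂ)
    (Ωp Ωp' C C' : ℂ_[p]) (L L' : UnrSeries p) (m : ℕ) (x₀ : ℂ_[p]) (φ φ' : ℕ → HeckeCharacter K)
    (r r' : ℕ → FramedGaloisRep K (PadicAlgCl p) 1)
    (hm : 0 < m) (hx : Tendsto (fun k ↦ x₀ ^ p ^ k) atTop (𝓝 1))
    (hunr : ∀ k (v : HeightOneSpectrum (𝓞 K)), (φ k).IsUnramifiedAt v)
    (hinf : ∀ k, (φ k).HasInfinityType (fun _ ↦ ((m * p ^ k : ℕ) : ℤ))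
      (fun _ ↦ -((m * p ^ k : ℕ) : ℤ)))
    (hr : ∀ k, IsPAdicAvatarOf ι (φ k) (r k)) (hrκ : ∀ k, FactorsThroughZp κ (r k))
    (hval : ∀ k, avatarValueAt (r k) γ = x₀ ^ p ^ k)
    (hunr' : ∀ k (v : HeightOneSpectrum (𝓞 K)), (φ' k).IsUnramifiedAt v)
    (hinf' : ∀ k, (φ' k).HasInfinityType (fun _ ↦ ((2 * m * p ^ k : ℕ) : ℤ))
      (fun _ ↦ -((2 * m * p ^ k : ℕ) : ℤ)))
    (hr' : ∀ k, IsPAdicAvatarOf ι (φ' k) (r' k)) (hrκ' : ∀ k, FactorsThroughZp κ (r' k))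
    (hval' : ∀ k, avatarValueAt (r' k) γ = x₀ ^ (2 * p ^ k))
    (hΩK : ΩK ≠ 0) (hΩK' : ΩK' ≠ 0) (hΩp : Ωp ≠ 0) (hΩp' : Ωp' ≠ 0) (hC : C ≠ 0) (hC' : C' ≠ 0)
    (hL : IsBDPLFunctionUpTo C ι 𝔭 κ γ f ΩK Ωp L)
    (hL' : IsBDPLFunctionUpTo C' ι 𝔭 κ γ f ΩK' Ωp' L') :
    ((PowerSeries.constantCoeff L' : unrIntegers p) : ℂ_[p]) =
      C' / C * ((PowerSeries.constantCoeff L : unrIntegers p) : ℂ_[p]) := by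
  have hp : p.Prime := Fact.out
  -- the points `T_k = x₀^(p^k) − 1 → 0`
  set T : ℕ → ℂ_[p] := fun k ↦ x₀ ^ p ^ k - 1 with hT
  have hT0 : Tendsto T atTop (𝓝 0) := by
    have h := hx.sub_const 1
    rwa [sub_self] at h
  -- the period ratio `β`, the factors `a_k = β^(m p^k) ≠ 0`, the constant `A = C'/C ≠ 0`
  set β : ℂ_[p] := ((ι.symm ((ΩK / ΩK') ^ 4) : PadicAlgCl p) : ℂ_[p]) * (Ωp' / Ωp) ^ 4 with hβ
  have hβ0 : β ≠ 0 := by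
    refine mul_ne_zero ?_ (pow_ne_zero _ (div_ne_zero hΩp' hΩp))
    rw [PadicComplex.coe_eq]
    exact (map_ne_zero_iff _ (algebraMap (PadicAlgCl p) ℂ_[p]).injective).mpr
      ((map_ne_zero_iff _ ι.symm.injective).mpr (pow_ne_zero _ (div_ne_zero hΩK hΩK')))
  set a : ℕ → ℂ_[p] := fun k ↦ β ^ (m * p ^ k) with ha
  have ha0 : ∀ k, a k ≠ 0 := fun k ↦ pow_ne_zero _ hβ0
  have hA : C' / C ≠ 0 := div_ne_zero hC' hC
  -- exponents are positive
  have hn : ∀ k, 0 < m * p ^ k := fun k ↦ Nat.mul_pos hm (pow_pos hp.pos k)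
  have hn' : ∀ k, 0 < 2 * m * p ^ k :=
    fun k ↦ Nat.mul_pos (Nat.mul_pos two_pos hm) (pow_pos hp.pos k)
  -- the second supply's points are `T_k (T_k + 2)`
  have hT' : ∀ k, x₀ ^ (2 * p ^ k) - 1 = T k * (T k + 2) := by
    intro k
    simp only [hT]
    ring
  -- values of the first frame
  set v : ℕ → ℂ_[p] := fun k ↦
    C * (((ι.symm (bdpInterpolationValue p f 𝔭 (φ k) (m * p ^ k) ΩK) : PadicAlgCl p) : ℂ_[p]) *
      Ωp ^ (4 * (m * p ^ k))) with hv
  set w : ℕ → ℂ_[p] := fun k ↦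
    C * (((ι.symm (bdpInterpolationValue p f 𝔭 (φ' k) (2 * m * p ^ k) ΩK) : PadicAlgCl p) : ℂ_[p]) *
      Ωp ^ (4 * (2 * m * p ^ k))) with hw
  have hLv : ∀ k, L.HasValueAt (T k) (v k) := by
    intro k
    have h := hL.hasValueAt (hn k) (hunr k) (hinf k) (hr k) (hrκ k)
    rwa [hval k] at h
  have hLw : ∀ k, L.HasValueAt (T k * (T k + 2)) (w k) := by
    intro k
    have h := hL.hasValueAt (hn' k) (hunr' k) (hinf' k) (hr' k) (hrκ' k)
    rwa [hval' k, hT' k] at h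
  -- values of the second frame, tied by `A·a_k` and `A·a_k²`
  have hL'v : ∀ k, L'.HasValueAt (T k) (C' / C * a k * v k) := by
    intro k
    have h := hasValueAt_frameUpTo_rescale hΩK hΩK' hΩp hC hL' (hn k) (hunr k) (hinf k) (hr k)
      (hrκ k)
    rw [hval k] at h
    simpa only [ha, hv, hβ] using h
  have hL'w : ∀ k, L'.HasValueAt (T k * (T k + 2)) (C' / C * a k ^ 2 * w k) := by
    intro k
    have h := hasValueAt_frameUpTo_rescale hΩK hΩK' hΩp hC hL' (hn' k) (hunr' k) (hinf' k) (hr' k)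
      (hrκ' k)
    have hpow : (((ι.symm ((ΩK / ΩK') ^ 4) : PadicAlgCl p) : ℂ_[p]) * (Ωp' / Ωp) ^ 4) ^
        (2 * m * p ^ k) = a k ^ 2 := by
      simp only [ha, hβ, ← pow_mul]
      congr 1
      ring
    rw [hval' k, hT' k, hpow] at h
    simpa only [hw] using h
  exact coe_constantCoeff_eq_mul_of_values_mul_sq hT0 ha0 hA hLv hL'v hLw hL'w

end Summit.BirchSwinnertonDyer.BirchSwinnertonDyer.Theorems.CongruentShaFreeCutBDPUpToRigidity

end
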